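import Mathlib

/-!
# Crux `NewtonTauWeak` (stmt-ValiantsHypothesis-5904), line `slope-ladder`: the `r = 3` slice of STUB 1 is impossible

STUB 1 of `Cruxes/NewtonTauWeak/Lines/slope_ladder.lean` (`stub_blockConvexBound`) asks for SOME block count `r ≥ 2`
and SOME `δ > 0` such that every convexly independent subset of an `r`-fold Minkowski sum of planar `N`-sets has
`≤ C (N+2)^{(2/3-δ) r}` points.  This file proves, sorry-free and without new definitions, that the witness `r` can NOT
be `3`:

* `parabola_convexIndependent` — any set of points on the parabola `y = x²` is convexly independent
  (the linear functional `z ↦ z₁ - 2x₀z₀` is strictly minimal at `(x₀, x₀²)`, by `(x - x₀)² > 0`);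
* `three_sets_parabola n` — for every `n`, three planar sets `A, B, C` with `|A|, |B| ≤ n`, `|C| ≤ 2n` and `n²` points
  of `A + B + C` on the parabola: `A = {(4^i, 16^i)}_{i<n}`, `B = {(4^{n+j}, 16^{n+j})}_{j<n}`, `C = {(0, 2·4^{n+m})}_{m<2n}`,
  using `(u+v)² = u² + v² + 2uv` and that the cross term `uv = 4^{n+i+j}` takes only `2n-1` values on these geometric
  progressions.  Hence `M_3(2n) ≥ n²`, i.e. `M_3(N) = Θ(N²)`: the Eisenbrand–Pach–Rothvoß–Sopher exponent `2/3` per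
  summand is tight for three summands, with all points on ONE parabola (the line card §3 had a piecewise-parabolic chain);
* `blockConvexBound_three_false` — hence no `δ > 0`, `C` make the `r = 3` bound hold.

So the content of STUB 1 is `r ≥ 4` ([BBFKOTT10, §5] "determine `M_k(n)` for `k ≥ 3`" is settled for `k = 3` up to
constants; `k = 2` is Bílka–Buchin–Fulek–Kiyomi–Okamoto–Tanigawa–Tóth 2010, doi:10.37236/484).  Helper for the crux item
(`--supports`); it does not bear on `NewtonTauWeak` itself or on `VP ≠ VNP`.
-/

set_option linter.dupNamespace false

namespace Summit.ValiantsHypothesis.ValiantsHypothesis.Theorems.NewtonFramesNewtonTauWeak.BlockConvexThree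

open scoped BigOperators Pointwise

noncomputable section

/-- Coordinatewise addition of planar points written as `![x, y]`. [folklore] -/
theorem vec2_add (x y x' y' : ℝ) : (![x, y] : Fin 2 → ℝ) + ![x', y'] = ![x + x', y + y'] := by
  funext i
  fin_cases i <;> simp

/-- **Points on the parabola `y = x²` are convexly independent**: at `s = (x₀, x₀²)` the linear functional
`z ↦ z₁ - 2 x₀ z₀` is strictly smaller than at every other point of the parabola (by `(x - x₀)² > 0`), so `s` is not
in the convex hull of the others. [folklore] -/
theorem parabola_convexIndependent (S : Set (Fin 2 → ℝ)) (hS : ∀ s ∈ S, s 1 = s 0 ^ 2) :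
    ConvexIndependent ℝ (Subtype.val : S → (Fin 2 → ℝ)) := by
  rw [convexIndependent_set_iff_notMem_convexHull_sdiff]
  intro s hs hmem
  -- the strict supporting functional at `s`
  set f : (Fin 2 → ℝ) → ℝ := fun z => z 1 - 2 * s 0 * z 0 with hf
  have hlin : IsLinearMap ℝ f := by
    refine ⟨fun z w => ?_, fun c z => ?_⟩
    · simp only [hf, Pi.add_apply]; ring
    · simp only [hf, Pi.smul_apply, smul_eq_mul]; ring
  have hsub : S \ {s} ⊆ {z | f s < f z} := by
    intro z hz
    have hz1 : z 1 = z 0 ^ 2 := hS z hz.1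
    have hs1 : s 1 = s 0 ^ 2 := hS s hs
    have hne : z 0 ≠ s 0 := by
      intro h0
      apply hz.2
      have : z = s := by
        funext i
        fin_cases i
        · exact h0
        · show z 1 = s 1
          rw [hz1, hs1, h0]
      exact this
    have hpos : 0 < (z 0 - s 0) ^ 2 := by
      have : z 0 - s 0 ≠ 0 := sub_ne_zero.mpr hne
      positivity
    show f s < f z
    simp only [hf]
    nlinarith [hz1, hs1, hpos]
  have hhull : convexHull ℝ (S \ {s}) ⊆ {z | f s < f z} :=
    convexHull_min hsub (convex_halfSpace_gt hlin (f s))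
  have hlt : f s < f s := hhull hmem
  exact lt_irrefl _ hlt

/-- Injectivity of `(i, j) ↦ 4^i + 4^{n+j}` on `[n] × ℕ` (in `ℕ`): the high term decides `j`, then `i`. [folklore] -/
theorem key_injective {n i j i' j' : ℕ} (hi : i < n) (hi' : i' < n)
    (h : 4 ^ i + 4 ^ (n + j) = 4 ^ i' + 4 ^ (n + j')) : i = i' ∧ j = j' := by
  have h4 : 1 < 4 := by norm_num
  have hin : 4 ^ i < 4 ^ n := Nat.pow_lt_pow_right h4 hi
  have hin' : 4 ^ i' < 4 ^ n := Nat.pow_lt_pow_right h4 hi'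
  have hnj : 4 ^ n ≤ 4 ^ (n + j) := Nat.pow_le_pow_right (by norm_num) (Nat.le_add_right n j)
  have hnj' : 4 ^ n ≤ 4 ^ (n + j') := Nat.pow_le_pow_right (by norm_num) (Nat.le_add_right n j')
  have hj : j = j' := by
    by_contra hne
    rcases lt_or_gt_of_ne hne with hlt | hlt
    · have h1 : 4 ^ (n + j + 1) ≤ 4 ^ (n + j') := Nat.pow_le_pow_right (by norm_num) (by omega)
      rw [pow_succ] at h1
      generalize 4 ^ i = a at h hin
      generalize 4 ^ i' = a' at h hin'
      generalize 4 ^ (n + j) = d at h hnj h1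
      generalize 4 ^ (n + j') = d' at h hnj' h1
      generalize 4 ^ n = g at hin hin' hnj hnj'
      omega
    · have h1 : 4 ^ (n + j' + 1) ≤ 4 ^ (n + j) := Nat.pow_le_pow_right (by norm_num) (by omega)
      rw [pow_succ] at h1
      generalize 4 ^ i = a at h hin
      generalize 4 ^ i' = a' at h hin'
      generalize 4 ^ (n + j) = d at h hnj h1
      generalize 4 ^ (n + j') = d' at h hnj' h1
      generalize 4 ^ n = g at hin hin' hnj hnj'
      omega
  subst hj
  have hii : 4 ^ i = 4 ^ i' := Nat.add_right_cancel h
  exact ⟨Nat.pow_right_injective (le_refl 2) (by simpa using hii), rfl⟩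

/-- **`M_3(2n) ≥ n²`.** For every `n` there are three planar sets, two of at most `n` and one of at most `2n` points,
and `n²` points of their Minkowski sum in convex position — all on the parabola `y = x²`:
`A = {(4^i, 16^i)}`, `B = {(4^{n+j}, 16^{n+j})}`, `C = {(0, 2·4^{n+m})}`, `S = {(4^i+4^{n+j}, (4^i+4^{n+j})²)}`.
[this file; answers [BBFKOTT10, §5] for `k = 3` up to constants] -/
theorem three_sets_parabola (n : ℕ) :
    ∃ (P : Fin 3 → Finset (Fin 2 → ℝ)) (S : Finset (Fin 2 → ℝ)),
      (∀ i, (P i).card ≤ 2 * n) ∧ (P 0).card ≤ n ∧ (P 1).card ≤ n ∧ S ⊆ ∑ i, P i ∧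
        ConvexIndependent ℝ (Subtype.val : ↥(S : Set (Fin 2 → ℝ)) → (Fin 2 → ℝ)) ∧ S.card = n ^ 2 := by
  classical
  -- the three summands and the point set
  set A : Finset (Fin 2 → ℝ) :=
    (Finset.range n).image fun i => (![(4 : ℝ) ^ i, ((4 : ℝ) ^ i) ^ 2] : Fin 2 → ℝ) with hA
  set B : Finset (Fin 2 → ℝ) :=
    (Finset.range n).image fun j => (![(4 : ℝ) ^ (n + j), ((4 : ℝ) ^ (n + j)) ^ 2] : Fin 2 → ℝ) with hB
  set C : Finset (Fin 2 → ℝ) :=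
    (Finset.range (2 * n)).image fun m => (![(0 : ℝ), 2 * (4 : ℝ) ^ (n + m)] : Fin 2 → ℝ) with hC
  set S : Finset (Fin 2 → ℝ) :=
    (Finset.range n ×ˢ Finset.range n).image fun ij =>
      (![(4 : ℝ) ^ ij.1 + (4 : ℝ) ^ (n + ij.2), ((4 : ℝ) ^ ij.1 + (4 : ℝ) ^ (n + ij.2)) ^ 2] : Fin 2 → ℝ) with hS
  have hAc : A.card ≤ n := Finset.card_image_le.trans (by simp)
  have hBc : B.card ≤ n := Finset.card_image_le.trans (by simp)
  have hCc : C.card ≤ 2 * n := Finset.card_image_le.trans (by simp)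
  refine ⟨![A, B, C], S, ?_, ?_, ?_, ?_, ?_, ?_⟩
  · intro i
    fin_cases i
    · exact hAc.trans (by omega)
    · exact hBc.trans (by omega)
    · exact hCc
  · exact hAc
  · exact hBc
  · -- S ⊆ A + B + C :  (u+v, (u+v)²) = (u,u²) + (v,v²) + (0, 2uv),  2uv = 2·4^{n+i+j}
    rw [Fin.sum_univ_three]
    intro s hs
    obtain ⟨⟨i, j⟩, hij, rfl⟩ := Finset.mem_image.1 hs
    simp only [Finset.mem_product, Finset.mem_range] at hij
    have ha : (![(4 : ℝ) ^ i, ((4 : ℝ) ^ i) ^ 2] : Fin 2 → ℝ) ∈ (![A, B, C] : Fin 3 → Finset (Fin 2 → ℝ)) 0 :=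
      Finset.mem_image.2 ⟨i, Finset.mem_range.2 hij.1, rfl⟩
    have hb : (![(4 : ℝ) ^ (n + j), ((4 : ℝ) ^ (n + j)) ^ 2] : Fin 2 → ℝ) ∈
        (![A, B, C] : Fin 3 → Finset (Fin 2 → ℝ)) 1 :=
      Finset.mem_image.2 ⟨j, Finset.mem_range.2 hij.2, rfl⟩
    have hc : (![(0 : ℝ), 2 * (4 : ℝ) ^ (n + (i + j))] : Fin 2 → ℝ) ∈ (![A, B, C] : Fin 3 → Finset (Fin 2 → ℝ)) 2 :=
      Finset.mem_image.2 ⟨i + j, Finset.mem_range.2 (by omega), rfl⟩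
    refine Finset.mem_add.2 ⟨_, Finset.mem_add.2 ⟨_, ha, _, hb, rfl⟩, _, hc, ?_⟩
    rw [vec2_add, vec2_add]
    congr 1
    · ring
    · rw [show n + (i + j) = i + (n + j) by omega, pow_add]
      ring
  · -- all points of S lie on the parabola
    refine parabola_convexIndependent _ fun s hs => ?_
    obtain ⟨ij, -, rfl⟩ := Finset.mem_image.1 (Finset.mem_coe.1 hs)
    simp
  · -- |S| = n² : injectivity of (i,j) ↦ 4^i + 4^{n+j}
    rw [hS, Finset.card_image_of_injOn, Finset.card_product, Finset.card_range, sq]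
    rintro ⟨i, j⟩ hij ⟨i', j'⟩ hij' h
    simp only [Finset.coe_product, Set.mem_prod, Finset.mem_coe, Finset.mem_range] at hij hij'
    have h0 : (4 : ℝ) ^ i + (4 : ℝ) ^ (n + j) = (4 : ℝ) ^ i' + (4 : ℝ) ^ (n + j') := by
      simpa using congrFun h 0
    have hnat : 4 ^ i + 4 ^ (n + j) = 4 ^ i' + 4 ^ (n + j') := by exact_mod_cast h0
    obtain ⟨rfl, rfl⟩ := key_injective hij.1 hij'.1 hnat
    rfl

/-- **The `r = 3` slice of STUB 1 is false**: no `δ > 0` and `C` bound convexly independent subsets of three-fold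
Minkowski sums of planar `N`-sets by `C (N+2)^{(2/3-δ)·3}` (take `N = 2n` and the `n²` parabola points: for `2 - 3δ ≥ 0`
this forces `n^{3δ} ≤ C·4^{2-3δ}`, for `2 - 3δ < 0` it forces `n² ≤ C`; both fail for large `n`).  So any witness of
`stub_blockConvexBound` has `r ≠ 3` (and `r ≠ 2` by [BBFKOTT10, Thm 1]). -/
theorem blockConvexBound_three_false (δ C : ℝ) (hδ : 0 < δ) :
    ¬ ∀ (N : ℕ) (P : Fin 3 → Finset (Fin 2 → ℝ)) (S : Finset (Fin 2 → ℝ)),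
        (∀ i, (P i).card ≤ N) → S ⊆ ∑ i, P i →
          ConvexIndependent ℝ (Subtype.val : ↥(S : Set (Fin 2 → ℝ)) → (Fin 2 → ℝ)) →
            (S.card : ℝ) ≤ C * ((N : ℝ) + 2) ^ ((2 / 3 - δ) * ((3 : ℕ) : ℝ)) := by
  intro H
  -- the bound specialised to the parabola configuration: n² ≤ C (2n+2)^{2-3δ}
  have hbound : ∀ n : ℕ, ((n : ℝ) ^ 2) ≤ C * ((((2 * n : ℕ) : ℝ)) + 2) ^ ((2 / 3 - δ) * ((3 : ℕ) : ℝ)) := by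
    intro n
    obtain ⟨P, S, hP, -, -, hS, hci, hcard⟩ := three_sets_parabola n
    have := H (2 * n) P S hP hS hci
    rw [hcard] at this
    exact_mod_cast this
  set e : ℝ := (2 / 3 - δ) * ((3 : ℕ) : ℝ) with he
  have he' : e = 2 - 3 * δ := by rw [he]; push_cast; ring
  -- `0 ≤ C`, from the bound at `n = 1`
  have h4pos : (0 : ℝ) < (4 : ℝ) ^ e := Real.rpow_pos_of_pos (by norm_num) _
  have h1' : (1 : ℝ) ≤ C * (4 : ℝ) ^ e := by
    have h1 := hbound 1
    norm_num at h1
    exact h1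
  have hC : 0 ≤ C := by
    by_contra hC'
    push Not at hC'
    have : C * (4 : ℝ) ^ e < 0 := mul_neg_of_neg_of_pos hC' h4pos
    linarith
  by_cases he0 : 0 ≤ e
  · -- eventually n^{3δ} > C 4^e, while n² ≤ C (2n+2)^e ≤ C 4^e n^e forces n^{3δ} ≤ C 4^e
    have hev : ∀ᶠ n : ℕ in Filter.atTop, C * (4 : ℝ) ^ e < (n : ℝ) ^ (3 * δ) :=
      ((tendsto_rpow_atTop (by linarith : 0 < 3 * δ)).comp tendsto_natCast_atTop_atTop).eventually_gt_atTop _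
    obtain ⟨n, hn, hn1⟩ := (hev.and (Filter.eventually_ge_atTop 1)).exists
    have hn1' : (1 : ℝ) ≤ n := by exact_mod_cast hn1
    have hnpos : (0 : ℝ) < n := by linarith
    have hb := hbound n
    have h2n : (((2 * n : ℕ) : ℝ) + 2) ≤ 4 * (n : ℝ) := by push_cast; linarith
    have h2n0 : (0 : ℝ) ≤ ((2 * n : ℕ) : ℝ) + 2 := by positivity
    have hne : (n : ℝ) ^ (2 : ℝ) = (n : ℝ) ^ e * (n : ℝ) ^ (3 * δ) := by
      rw [← Real.rpow_add hnpos, he']; ring_nf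
    have hn2 : ((n : ℝ) ^ 2 : ℝ) = (n : ℝ) ^ (2 : ℝ) := by norm_cast
    have hpow : (((2 * n : ℕ) : ℝ) + 2) ^ e ≤ (4 * (n : ℝ)) ^ e := Real.rpow_le_rpow h2n0 h2n he0
    have h4n : (4 * (n : ℝ)) ^ e = (4 : ℝ) ^ e * (n : ℝ) ^ e := Real.mul_rpow (by norm_num) hnpos.le
    have hmain : (n : ℝ) ^ e * (n : ℝ) ^ (3 * δ) ≤ (n : ℝ) ^ e * (C * (4 : ℝ) ^ e) := by
      calc (n : ℝ) ^ e * (n : ℝ) ^ (3 * δ) = (n : ℝ) ^ 2 := by rw [hn2, hne]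
        _ ≤ C * (((2 * n : ℕ) : ℝ) + 2) ^ e := hb
        _ ≤ C * ((4 : ℝ) ^ e * (n : ℝ) ^ e) := by rw [← h4n]; exact mul_le_mul_of_nonneg_left hpow hC
        _ = (n : ℝ) ^ e * (C * (4 : ℝ) ^ e) := by ring
    have hne_pos : (0 : ℝ) < (n : ℝ) ^ e := Real.rpow_pos_of_pos hnpos _
    have := le_of_mul_le_mul_left hmain hne_pos
    linarith
  · -- e < 0: then (2m+2)^e ≤ 1, so m² ≤ C for every m — absurd for m > C
    push Not at he0
    obtain ⟨m, hm⟩ := exists_nat_gt C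
    have hbm := hbound (m + 1)
    have hm1 : (1 : ℝ) ≤ ((m + 1 : ℕ) : ℝ) := by exact_mod_cast Nat.succ_pos m
    have hpowm : (((2 * (m + 1) : ℕ) : ℝ) + 2) ^ e ≤ 1 :=
      Real.rpow_le_one_of_one_le_of_nonpos (by push_cast; linarith) he0.le
    have hsqm : (((m + 1 : ℕ) : ℝ)) ^ 2 ≤ C := by
      calc (((m + 1 : ℕ) : ℝ)) ^ 2 ≤ C * (((2 * (m + 1) : ℕ) : ℝ) + 2) ^ e := hbm
        _ ≤ C * 1 := mul_le_mul_of_nonneg_left hpowm hC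
        _ = C := mul_one C
    have hle : (((m + 1 : ℕ) : ℝ)) ≤ (((m + 1 : ℕ) : ℝ)) ^ 2 := by
      calc (((m + 1 : ℕ) : ℝ)) = (((m + 1 : ℕ) : ℝ)) * 1 := (mul_one _).symm
        _ ≤ (((m + 1 : ℕ) : ℝ)) * (((m + 1 : ℕ) : ℝ)) := mul_le_mul_of_nonneg_left hm1 (by positivity)
        _ = _ := (sq _).symm
    have hmm : (m : ℝ) < ((m + 1 : ℕ) : ℝ) := by push_cast; linarith
    linarith

end

end Summit.ValiantsHypothesis.ValiantsHypothesis.Theorems.NewtonFramesNewtonTauWeak.BlockConvexThree
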